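import Literature.AlgebraicGeometry.Morphisms.FormalModuleTower
import HarnessLib

/-!
# Cokernels of morphisms of coherent formal modules are computed levelwise (quotient model)

Görtz–Wedhorn, *Algebraic Geometry II* (2023), Prop. 24.91 (2) and Rem. 24.92 (p. 565): for a
morphism `u : ℱ → 𝒢` of coherent `𝒪_{X/Z}`-modules, `Coker(u) = (Coker(u_n))_n`. In the tree's
quotient model (`Morphisms/FormalModuleTower`: towers `F : ℕᵒᵖ ⥤ Mod(𝒪_X)` with `IsFormalTower a F`)
this file proves exactly that:

* `cokerTower u` — the tower of levelwise cokernels `C_n = coker u_n`, with the levelwise quotient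
  map `cokerTowerπ u : G → cokerTower u` (a morphism of towers) and `u ≫ cokerTowerπ u = 0`;
* `IsFormalTower.cokerTower` — **if `F` has epimorphic transition maps (e.g. is a formal tower) and
  `G` is a formal tower, then `cokerTower u` is a formal tower**: `aⁿ⁺¹C_n = 0`, `C_{n+1} → C_n` is an
  epimorphism, and `C_n = C_{n+1}/aⁿ⁺¹C_{n+1}` (right exactness: a map `C_{n+1} → A` killing `aⁿ⁺¹`
  descends through `G_n = G_{n+1}/aⁿ⁺¹G_{n+1}` and then through `C_n = G_n/u_n(F_n)`, using that
  `F_{n+1} → F_n` is onto);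
* `coh_cokerTower` — the levels are coherent when those of `F`, `G` are (locally noetherian `X`).

Together with `Morphisms/FormalModuleKernel` (kernels of levelwise epimorphisms) this provides the
kernel/cokernel calculus of the abelian category of coherent formal modules of Prop. 24.91.
Everything is proved; no named facts.

## References

* U. Görtz, T. Wedhorn, *Algebraic Geometry II: Cohomology of Schemes*, Springer Spektrum (2023),
  Prop. 24.91, Rem. 24.92 (p. 565). [GortzWedhorn2023]
* A. Grothendieck, EGA III₁ (1961), 5.1. [EGAIII1]
-/

noncomputable section

open CategoryTheory AlgebraicGeometry Limits TopologicalSpace Opposite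
open Literature.AlgebraicGeometry.Modules

universe u

namespace Literature.AlgebraicGeometry.Morphisms

variable {X : Scheme.{u}} (a : Γ(X, ⊤)) {F G : ℕᵒᵖ ⥤ X.Modules} (u : F ⟶ G)

/-! ### The tower of levelwise cokernels -/

/-- **The tower of levelwise cokernels `C_n = coker u_n`** of a morphism of towers.
[cite: GortzWedhorn2023, Prop. 24.91 (2) (p. 565)] -/
@[simps obj, reducible]
def cokerTower : ℕᵒᵖ ⥤ X.Modules where
  obj k := cokernel (u.app k)
  map {k k'} h := cokernel.map (u.app k) (u.app k') (F.map h) (G.map h) (u.naturality h).symm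
  map_id k := by
    apply coequalizer.hom_ext
    simp
  map_comp {k k' k''} h h' := by
    apply coequalizer.hom_ext
    simp

/-- The levelwise quotient map `G_n → C_n`, as a morphism of towers. [folklore] -/
@[simps app]
def cokerTowerπ : G ⟶ cokerTower u where
  app k := cokernel.π (u.app k)
  naturality k k' h := by simp [cokerTower]

/-- `F → G → cokerTower u` vanishes. [folklore] -/
theorem comp_cokerTowerπ : u ≫ cokerTowerπ u = 0 := by
  refine NatTrans.ext (funext fun k => ?_)
  rw [NatTrans.comp_app, NatTrans.app_zero, cokerTowerπ_app, cokernel.condition]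

/-- The transition maps of the cokernel tower commute with the quotient maps. [folklore] -/
@[reassoc]
theorem π_cokerTower_map {k k' : ℕᵒᵖ} (h : k ⟶ k') :
    cokernel.π (u.app k) ≫ (cokerTower u).map h = G.map h ≫ cokernel.π (u.app k') := by
  simp [cokerTower]

/-- In particular for the successive transition maps. [folklore] -/
@[reassoc]
theorem π_towerπ_cokerTower (n : ℕ) :
    cokernel.π (u.app ⟨n + 1⟩) ≫ towerπ (cokerTower u) n = towerπ G n ≫ cokernel.π (u.app ⟨n⟩) :=
  π_cokerTower_map u _

/-- The levels of the cokernel tower are coherent (locally noetherian `X`).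
[cite: Hartshorne1977, II Prop. 5.7 (p. 114)] -/
theorem coh_cokerTower [IsLocallyNoetherian X] (hFc : ∀ n, Coh (F.obj ⟨n⟩))
    (hGc : ∀ n, Coh (G.obj ⟨n⟩)) (n : ℕ) : Coh ((cokerTower u).obj ⟨n⟩) :=
  Coh.cokernel _ (hFc _) (hGc _)

/-! ### The cokernel tower is a formal tower -/

namespace IsFormalTower

variable {a u} (hFe : ∀ n, Epi (towerπ F n)) (hG : IsFormalTower a G)

include hG in
/-- `aⁿ⁺¹` kills `C_n`. [folklore] -/
theorem killed_cokerTower (n : ℕ) : globalScalar ((cokerTower u).obj ⟨n⟩) (a ^ (n + 1)) = 0 := by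
  rw [← cancel_epi (cokernel.π (u.app ⟨n⟩)), ← globalScalar_comp, hG.killed n, zero_comp, comp_zero]

include hG in
/-- The transition maps `C_{n+1} → C_n` are epimorphisms. [folklore] -/
theorem epi_towerπ_cokerTower (n : ℕ) : Epi (towerπ (cokerTower u) n) := by
  haveI := hG.epi n
  have h : Epi (towerπ G n ≫ cokernel.π (u.app ⟨n⟩)) := epi_comp _ _
  rw [← π_towerπ_cokerTower] at h
  exact @epi_of_epi _ _ _ _ _ (cokernel.π (u.app ⟨n + 1⟩)) _ h

/-- A map `C_{n+1} → A` killing `aⁿ⁺¹` gives `G_{n+1} → C_{n+1} → A` killing `aⁿ⁺¹`, which descends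
to `G_n = G_{n+1}/aⁿ⁺¹G_{n+1}`. [folklore] -/
def descG (n : ℕ) {A : X.Modules} (k : (cokerTower u).obj ⟨n + 1⟩ ⟶ A)
    (hk : globalScalar ((cokerTower u).obj ⟨n + 1⟩) (a ^ (n + 1)) ≫ k = 0) : G.obj ⟨n⟩ ⟶ A :=
  haveI := hG.epi n
  (hG.exact n).desc (cokernel.π (u.app ⟨n + 1⟩) ≫ k)
    (by rw [globalScalar_comp_assoc, hk, comp_zero])

/-- The defining property of `descG`. [folklore] -/
@[reassoc]
theorem towerπ_descG (n : ℕ) {A : X.Modules} (k : (cokerTower u).obj ⟨n + 1⟩ ⟶ A)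
    (hk : globalScalar ((cokerTower u).obj ⟨n + 1⟩) (a ^ (n + 1)) ≫ k = 0) :
    towerπ G n ≫ hG.descG n k hk = cokernel.π (u.app ⟨n + 1⟩) ≫ k := by
  haveI := hG.epi n
  exact (hG.exact n).g_desc _ _

include hFe in
/-- `descG` kills `u_n` (because `F_{n+1} → F_n` is onto). [folklore] -/
theorem app_descG (n : ℕ) {A : X.Modules} (k : (cokerTower u).obj ⟨n + 1⟩ ⟶ A)
    (hk : globalScalar ((cokerTower u).obj ⟨n + 1⟩) (a ^ (n + 1)) ≫ k = 0) :
    u.app ⟨n⟩ ≫ hG.descG n k hk = 0 := by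
  haveI := hFe n
  rw [← cancel_epi (towerπ F n), ← towerπ_naturality_assoc, towerπ_descG, cokernel.condition_assoc,
    zero_comp, comp_zero]

/-- **Right exactness: a map `C_{n+1} → A` killing `aⁿ⁺¹` descends to `C_n`** (through
`G_n = G_{n+1}/aⁿ⁺¹G_{n+1}`, then through `C_n = G_n/u_n(F_n)` using that `F_{n+1} → F_n` is onto).
[cite: GortzWedhorn2023, Prop. 24.91 (2) (p. 565)] -/
def descCokerTower (n : ℕ) {A : X.Modules} (k : (cokerTower u).obj ⟨n + 1⟩ ⟶ A)
    (hk : globalScalar ((cokerTower u).obj ⟨n + 1⟩) (a ^ (n + 1)) ≫ k = 0) :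
    (cokerTower u).obj ⟨n⟩ ⟶ A :=
  cokernel.desc (u.app ⟨n⟩) (hG.descG n k hk) (app_descG hFe hG n k hk)

/-- The defining property of `descCokerTower`. [folklore] -/
@[reassoc]
theorem towerπ_descCokerTower (n : ℕ) {A : X.Modules} (k : (cokerTower u).obj ⟨n + 1⟩ ⟶ A)
    (hk : globalScalar ((cokerTower u).obj ⟨n + 1⟩) (a ^ (n + 1)) ≫ k = 0) :
    towerπ (cokerTower u) n ≫ descCokerTower hFe hG n k hk = k := by
  haveI := hG.epi n
  rw [← cancel_epi (cokernel.π (u.app ⟨n + 1⟩)), π_towerπ_cokerTower_assoc]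
  unfold descCokerTower
  rw [cokernel.π_desc, towerπ_descG]

include hFe hG in
/-- **The cokernel tower of a morphism from a tower with epimorphic transitions to a formal tower
is a formal tower** (cokernels of coherent formal modules are computed levelwise).
[cite: GortzWedhorn2023, Prop. 24.91 (2) and Rem. 24.92 (p. 565)] -/
theorem cokerTower : IsFormalTower a (Morphisms.cokerTower u) where
  killed := hG.killed_cokerTower
  epi := hG.epi_towerπ_cokerTower
  exact n := by
    haveI := hG.epi n
    haveI := hG.epi_towerπ_cokerTower (u := u) n
    refine ShortComplex.exact_of_g_is_cokernel _ (CokernelCofork.IsColimit.ofπ _ _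
      (fun k hk => descCokerTower hFe hG n k hk) (fun k hk => towerπ_descCokerTower hFe hG n k hk)
      (fun k hk m hm => ?_))
    haveI : Epi (towerπ G n ≫ cokernel.π (u.app ⟨n⟩)) := epi_comp _ _
    rw [← cancel_epi (towerπ (Morphisms.cokerTower u) n), hm, towerπ_descCokerTower]

end IsFormalTower

end Literature.AlgebraicGeometry.Morphisms

end
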